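import Mathlib
import Literature.NumberTheory.LucasSequences.RecurrenceIdentities
import Literature.NumberTheory.ContinuedFractions.FibonacciLucasNumbers

/-!
# Second-order recurrences: Catalan's identity, Melham's identity, the Gelin–Cesàro identity
# (Andrica–Bagdasar, *Recurrent Sequences*, Ch. 2 §2.2, Theorems 2.10–2.13)

Topic `NumberTheory/LucasSequences` (continues `RecurrenceIdentities.lean`; hypothesis form over a commutative ring:
`W (n+2) = P W (n+1) − Q W n`, `U` the solution with `U 0 = 0, U 1 = 1`).  Theorems only.

SOURCE (held): D. Andrica, O. Bagdasar, *Recurrent Sequences: Key Results, Applications, and Problems*, Springer 2020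
[AndricaBagdasar2020], Ch. 2 (chunks p0042–p0043), for `x_{n+2} = a x_{n+1} + b x_n`, `x_0 = α₀`, `x_1 = α₁`,
`D = aα₀α₁ + bα₀² − α₁²`, `y` the solution with `y_0 = 0, y_1 = 1`: **Theorem 2.10** (Melham)
`x_{n+1}x_{n+2}x_{n+6} − x_{n+3}³ = D(−b)^{n+1}(a³x_{n+2} − b²x_{n+1})` (2.50), proved from
`x_{n+1}x_{n+3} = x_{n+2}² + D(−b)^{n+1}` and `x_{n+6} = (a⁴+3a²b+b²)x_{n+2} + (a³b+2ab²)x_{n+1}`; **Theorem 2.11**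
(2.51) `F_{n+1}F_{n+2}F_{n+6} − F_{n+3}³ = (−1)ⁿF_n`, (2.52)–(2.54) for `L, P, Q`; **Theorem 2.12**
`x_{n−2}x_{n−1}x_{n+1}x_{n+2} = x_n⁴ + D(−b)^{n−2}(a² − b)x_n² − D²a²b^{2n−3}` (2.55), from "Catalan's identity
`x_{n+r}x_{n−r} = x_n² + D(−b)^{n−r}y_r²`, `r = 0, 1, …, n`"; **Theorem 2.13** (2.56) (Gelin–Cesàro 1880)
`F_n⁴ − F_{n−2}F_{n−1}F_{n+1}F_{n+2} = 1`, (2.57)–(2.59).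

RENDERING.  `a = P`, `b = −Q` (so `(−b)^k = Q^k`), `D = W₀W₂ − W₁²`; indices are shifted to avoid subtraction
(Catalan: `W_{m+2r}W_m = W_{m+r}² + DQ^m U_r²`; Gelin–Cesàro at `n + 2`).  PROOF of Catalan (not printed): both sides,
as functions of `r`, satisfy the third-order recurrence with characteristic roots `α², αβ, β²`
(`Z_{r+3} = (P²−Q)Z_{r+2} − Q(P²−Q)Z_{r+1} + Q³Z_r`) and agree for `r = 0, 1, 2`.  MISPRINTS disclosed: with the
book's own `D`, (2.52) reads `… = 5(−1)^{n+1}L_n` (printed coefficient `3`; check `n = 0`: `1·3·18 − 4³ = −10`) and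
(2.57) reads `L_n⁴ − L_{n−2}L_{n−1}L_{n+1}L_{n+2} = 25` (printed `9`; check `n = 2`: `81 − 56 = 25`); the corrected
values are typed.

WHAT IS TYPED: `solution_catalan` (Catalan's identity for an arbitrary solution), `solution_melham` (Thm 2.10),
`solution_gelin_cesaro` (Thm 2.12), the Fibonacci/Lucas instances `fib_melham` (2.51), `lucas_melham` ((2.52)
corrected), `fib_gelin_cesaro` (2.56), `lucas_gelin_cesaro` ((2.57) corrected), and the Pell/Pell–Lucas instances
(hypothesis form `P = 2`, `Q = −1`; no Pell-number definition exists in the tree) `pell_melham` (2.53),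
`pellLucas_melham` (2.54), `pell_gelin_cesaro` (2.58), `pellLucas_gelin_cesaro` (2.59).

## References
* [AndricaBagdasar2020] D. Andrica, O. Bagdasar, *Recurrent Sequences*, Problem Books in Mathematics, Springer 2020,
  Ch. 2, Theorems 2.10–2.13, Remark 2.6.
-/

namespace Literature.NumberTheory.LucasSequences

open Literature.NumberTheory.ContinuedFractions.FibonacciLucas

section CommRing

variable {R : Type*} [CommRing R] {P Q : R} {U W : ℕ → R}

/-- Squares (and, more generally, products `X_{k+c}Y_k`) of solutions satisfy the third-order recurrence with
roots `α², αβ, β²`: `Z_{k+3} = (P² − Q)Z_{k+2} − Q(P² − Q)Z_{k+1} + Q³Z_k`. [folklore] -/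
private theorem prod_rec3 {X Y : ℕ → R} (hX : ∀ n, X (n + 2) = P * X (n + 1) - Q * X n)
    (hY : ∀ n, Y (n + 2) = P * Y (n + 1) - Q * Y n) (k : ℕ) :
    X (k + 3) * Y (k + 3) = (P ^ 2 - Q) * (X (k + 2) * Y (k + 2)) - Q * (P ^ 2 - Q) * (X (k + 1) * Y (k + 1)) +
      Q ^ 3 * (X k * Y k) := by
  have hX3 : X (k + 3) = P * X (k + 2) - Q * X (k + 1) := hX (k + 1)
  have hY3 : Y (k + 3) = P * Y (k + 2) - Q * Y (k + 1) := hY (k + 1)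
  rw [hX3, hY3, hX k, hY k]; ring

/-- Uniqueness for the third-order recurrence. [folklore] -/
private theorem rec3_ext {c₂ c₁ c₀ : R} {Z Z' : ℕ → R}
    (hZ : ∀ k, Z (k + 3) = c₂ * Z (k + 2) - c₁ * Z (k + 1) + c₀ * Z k)
    (hZ' : ∀ k, Z' (k + 3) = c₂ * Z' (k + 2) - c₁ * Z' (k + 1) + c₀ * Z' k)
    (h0 : Z 0 = Z' 0) (h1 : Z 1 = Z' 1) (h2 : Z 2 = Z' 2) : ∀ k, Z k = Z' k := by
  intro k
  induction k using Nat.strong_induction_on with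
  | _ k ih =>
    match k, ih with
    | 0, _ => exact h0
    | 1, _ => exact h1
    | 2, _ => exact h2
    | (j + 3), ih => rw [hZ j, hZ' j, ih j (by omega), ih (j + 1) (by omega), ih (j + 2) (by omega)]

/-- **Catalan's identity for an arbitrary solution**: `W_{m+2r} W_m = W_{m+r}² + D Q^m U_r²` with `D = W₀W₂ − W₁²`
(the printed `x_{n+r}x_{n−r} = x_n² + D(−b)^{n−r}y_r²`, `n = m + r`).  For `r = 1` this is Cassini.
[cite: AndricaBagdasar2020, Thm 2.12, proof (Catalan's identity)] -/
theorem solution_catalan (hU0 : U 0 = 0) (hU1 : U 1 = 1) (hU : ∀ n, U (n + 2) = P * U (n + 1) - Q * U n)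
    (hW : ∀ n, W (n + 2) = P * W (n + 1) - Q * W n) (m r : ℕ) :
    W (m + 2 * r) * W m = W (m + r) ^ 2 + (W 0 * W 2 - W 1 ^ 2) * Q ^ m * U r ^ 2 := by
  -- both sides satisfy the third-order recurrence in `r`
  set Z : ℕ → R := fun r => W (m + 2 * r) * W m with hZ
  set Z' : ℕ → R := fun r => W (m + r) ^ 2 + (W 0 * W 2 - W 1 ^ 2) * Q ^ m * U r ^ 2 with hZ'
  have hrecZ : ∀ k, Z (k + 3) = (P ^ 2 - Q) * Z (k + 2) - Q * (P ^ 2 - Q) * Z (k + 1) + Q ^ 3 * Z k := by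
    intro k
    simp only [hZ]
    have e1 : W (m + 2 * (k + 1)) = P * W (m + 2 * k + 1) - Q * W (m + 2 * k) := by
      rw [show m + 2 * (k + 1) = (m + 2 * k) + 2 by ring, hW]
    have e2 : W (m + 2 * (k + 2)) = P * W (m + 2 * k + 3) - Q * W (m + 2 * k + 2) := by
      rw [show m + 2 * (k + 2) = (m + 2 * k + 2) + 2 by ring, hW]
    have e3 : W (m + 2 * (k + 3)) = P * W (m + 2 * k + 5) - Q * W (m + 2 * k + 4) := by
      rw [show m + 2 * (k + 3) = (m + 2 * k + 4) + 2 by ring, hW]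
    have f2 : W (m + 2 * k + 2) = P * W (m + 2 * k + 1) - Q * W (m + 2 * k) := hW _
    have f3 : W (m + 2 * k + 3) = P * W (m + 2 * k + 2) - Q * W (m + 2 * k + 1) := hW _
    have f4 : W (m + 2 * k + 4) = P * W (m + 2 * k + 3) - Q * W (m + 2 * k + 2) := hW _
    have f5 : W (m + 2 * k + 5) = P * W (m + 2 * k + 4) - Q * W (m + 2 * k + 3) := hW _
    rw [e1, e2, e3, f5, f4, f3, f2]; ring
  have hrecZ' : ∀ k, Z' (k + 3) = (P ^ 2 - Q) * Z' (k + 2) - Q * (P ^ 2 - Q) * Z' (k + 1) + Q ^ 3 * Z' k := by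
    intro k
    simp only [hZ']
    have hWm : ∀ n, W (m + (n + 2)) = P * W (m + (n + 1)) - Q * W (m + n) := fun n => hW (m + n)
    have h1 := prod_rec3 (X := fun n => W (m + n)) (Y := fun n => W (m + n)) hWm hWm k
    have h2 := prod_rec3 hU hU k
    calc W (m + (k + 3)) ^ 2 + (W 0 * W 2 - W 1 ^ 2) * Q ^ m * U (k + 3) ^ 2
        = W (m + (k + 3)) * W (m + (k + 3)) + (W 0 * W 2 - W 1 ^ 2) * Q ^ m * (U (k + 3) * U (k + 3)) := by ring
      _ = _ := by rw [h1, h2]; ring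
  have hc1 := solution_cassini hW m
  have hU2 : U 2 = P := by rw [hU 0, hU0, hU1]; ring
  have f2 : W (m + 2) = P * W (m + 1) - Q * W m := hW _
  have f3 : W (m + 3) = P * W (m + 2) - Q * W (m + 1) := hW _
  have f4 : W (m + 4) = P * W (m + 3) - Q * W (m + 2) := hW _
  have b0 : Z 0 = Z' 0 := by
    show W (m + 2 * 0) * W m = W (m + 0) ^ 2 + (W 0 * W 2 - W 1 ^ 2) * Q ^ m * U 0 ^ 2
    rw [hU0, Nat.mul_zero, Nat.add_zero]; ring
  have b1 : Z 1 = Z' 1 := by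
    show W (m + 2 * 1) * W m = W (m + 1) ^ 2 + (W 0 * W 2 - W 1 ^ 2) * Q ^ m * U 1 ^ 2
    rw [hU1, Nat.mul_one]
    linear_combination hc1
  have b2 : Z 2 = Z' 2 := by
    show W (m + 2 * 2) * W m = W (m + 2) ^ 2 + (W 0 * W 2 - W 1 ^ 2) * Q ^ m * U 2 ^ 2
    rw [hU2, show m + 2 * 2 = m + 4 from rfl, f4, f3]
    rw [f2] at hc1 ⊢
    linear_combination (P ^ 2) * hc1
  have key := rec3_ext hrecZ hrecZ' b0 b1 b2
  exact key r

/-- **Melham's identity (Theorem 2.10)** for an arbitrary solution: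
`W_{n+1}W_{n+2}W_{n+6} − W_{n+3}³ = D·Q^{n+1}(P³W_{n+2} − Q²W_{n+1})`, `D = W₀W₂ − W₁²` (the printed
`D(−b)^{n+1}(a³x_{n+2} − b²x_{n+1})`). [cite: AndricaBagdasar2020, Thm 2.10 (2.50)] -/
theorem solution_melham (hW : ∀ n, W (n + 2) = P * W (n + 1) - Q * W n) (n : ℕ) :
    W (n + 1) * W (n + 2) * W (n + 6) - W (n + 3) ^ 3 =
      (W 0 * W 2 - W 1 ^ 2) * Q ^ (n + 1) * (P ^ 3 * W (n + 2) - Q ^ 2 * W (n + 1)) := by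
  have hc := solution_cassini hW (n + 1)
  have f3 : W (n + 3) = P * W (n + 2) - Q * W (n + 1) := hW _
  have f4 : W (n + 4) = P * W (n + 3) - Q * W (n + 2) := hW _
  have f5 : W (n + 5) = P * W (n + 4) - Q * W (n + 3) := hW _
  have f6 : W (n + 6) = P * W (n + 5) - Q * W (n + 4) := hW _
  rw [show n + 1 + 2 = n + 3 from rfl, show n + 1 + 1 = n + 2 from rfl, f3] at hc
  rw [f6, f5, f4, f3]
  linear_combination (P ^ 3 * W (n + 2) - Q ^ 2 * W (n + 1)) * hc

/-- **Theorem 2.12** for an arbitrary solution (Catalan with `r = 1, 2`):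
`W_n W_{n+1} W_{n+3} W_{n+4} = W_{n+2}⁴ + D Qⁿ (P² + Q) W_{n+2}² + D² P² Q^{2n+1}`, `D = W₀W₂ − W₁²` (the printed
`x_{n−2}x_{n−1}x_{n+1}x_{n+2} = x_n⁴ + D(−b)^{n−2}(a²−b)x_n² − D²a²b^{2n−3}` at `n + 2`, with `b = −Q`).
[cite: AndricaBagdasar2020, Thm 2.12 (2.55)] -/
theorem solution_gelin_cesaro (hU0 : U 0 = 0) (hU1 : U 1 = 1) (hU : ∀ n, U (n + 2) = P * U (n + 1) - Q * U n)
    (hW : ∀ n, W (n + 2) = P * W (n + 1) - Q * W n) (n : ℕ) :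
    W n * W (n + 1) * W (n + 3) * W (n + 4) =
      W (n + 2) ^ 4 + (W 0 * W 2 - W 1 ^ 2) * Q ^ n * (P ^ 2 + Q) * W (n + 2) ^ 2 +
        (W 0 * W 2 - W 1 ^ 2) ^ 2 * P ^ 2 * Q ^ (2 * n + 1) := by
  have h2 := solution_catalan hU0 hU1 hU hW n 2
  have h1 := solution_catalan hU0 hU1 hU hW (n + 1) 1
  have hU2 : U 2 = P := by rw [hU 0, hU0, hU1]; ring
  rw [hU2, show n + 2 * 2 = n + 4 by ring] at h2
  rw [hU1, show n + 1 + 2 * 1 = n + 3 by ring, show n + 1 + 1 = n + 2 by ring, pow_succ] at h1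
  rw [pow_add, pow_mul]
  linear_combination (W (n + 3) * W (n + 1)) * h2 + (W (n + 2) ^ 2 + (W 0 * W 2 - W 1 ^ 2) * Q ^ n * P ^ 2) * h1

end CommRing

/-! ## Fibonacci and Lucas numbers (Theorems 2.11, 2.13) -/

section Fibonacci

/-- [folklore] -/
private theorem fibZ_rec'' (n : ℕ) :
    ((Nat.fib (n + 2) : ℕ) : ℤ) = 1 * (Nat.fib (n + 1) : ℕ) - (-1) * (Nat.fib n : ℕ) := by
  rw [Nat.fib_add_two]; push_cast; ring

/-- [folklore] -/
private theorem lucasZ_rec'' (n : ℕ) :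
    ((lucas (n + 2) : ℕ) : ℤ) = 1 * (lucas (n + 1) : ℕ) - (-1) * (lucas n : ℕ) := by
  rw [lucas_add_two]; push_cast; ring

/-- **(2.51)** (Melham): `F_{n+1}F_{n+2}F_{n+6} − F_{n+3}³ = (−1)ⁿF_n`. [cite: AndricaBagdasar2020, Thm 2.11 (2.51)] -/
theorem fib_melham (n : ℕ) :
    ((Nat.fib (n + 1) : ℕ) : ℤ) * (Nat.fib (n + 2) : ℕ) * (Nat.fib (n + 6) : ℕ) - (Nat.fib (n + 3) : ℕ) ^ 3 =
      (-1) ^ n * (Nat.fib n : ℕ) := by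
  have h := solution_melham (W := fun n => ((Nat.fib n : ℕ) : ℤ)) fibZ_rec'' n
  simp only [Nat.fib_zero, Nat.fib_one, Nat.fib_two, Nat.cast_zero, Nat.cast_one] at h
  rw [h, Nat.fib_add_two, pow_succ]; push_cast; ring

/-- **(2.52)** (Melham for Lucas numbers), CORRECTED coefficient: `L_{n+1}L_{n+2}L_{n+6} − L_{n+3}³ = 5(−1)^{n+1}L_n`
(the book prints `3(−1)^{n+1}L_n`; with its own `D = aα₀α₁ + bα₀² − α₁² = 5` the value is `5`, e.g. `n = 0`:
`1·3·18 − 64 = −10`). [cite: AndricaBagdasar2020, Thm 2.11 (2.52)] -/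
theorem lucas_melham (n : ℕ) :
    ((lucas (n + 1) : ℕ) : ℤ) * (lucas (n + 2) : ℕ) * (lucas (n + 6) : ℕ) - (lucas (n + 3) : ℕ) ^ 3 =
      5 * (-1) ^ (n + 1) * (lucas n : ℕ) := by
  have h := solution_melham (W := fun n => ((lucas n : ℕ) : ℤ)) lucasZ_rec'' n
  have l0 : lucas 0 = 2 := rfl
  have l1 : lucas 1 = 1 := rfl
  have l2 : lucas 2 = 3 := rfl
  simp only [l0, l1, l2, Nat.cast_ofNat, Nat.cast_one] at h
  rw [h, lucas_add_two]; push_cast; ring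

/-- **(2.56)** (Gelin–Cesàro 1880): `F_n⁴ − F_{n−2}F_{n−1}F_{n+1}F_{n+2} = 1`, typed at `n + 2`:
`F_nF_{n+1}F_{n+3}F_{n+4} + 1 = F_{n+2}⁴`. [cite: AndricaBagdasar2020, Thm 2.13 (2.56) & Remark 2.6] -/
theorem fib_gelin_cesaro (n : ℕ) :
    Nat.fib n * Nat.fib (n + 1) * Nat.fib (n + 3) * Nat.fib (n + 4) + 1 = Nat.fib (n + 2) ^ 4 := by
  have h := solution_gelin_cesaro (U := fun n => ((Nat.fib n : ℕ) : ℤ)) (W := fun n => ((Nat.fib n : ℕ) : ℤ))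
    (by simp) (by simp) fibZ_rec'' fibZ_rec'' n
  simp only [Nat.fib_zero, Nat.fib_one, Nat.fib_two, Nat.cast_zero, Nat.cast_one] at h
  have h' : ((Nat.fib n : ℕ) : ℤ) * (Nat.fib (n + 1) : ℕ) * (Nat.fib (n + 3) : ℕ) * (Nat.fib (n + 4) : ℕ) + 1 =
      ((Nat.fib (n + 2) : ℕ) : ℤ) ^ 4 := by
    rw [h, pow_add, pow_mul]; ring
  exact_mod_cast h'

/-- **(2.57)** for Lucas numbers, CORRECTED constant: `L_n⁴ − L_{n−2}L_{n−1}L_{n+1}L_{n+2} = 25` (the book prints `9`;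
with its own `D = 5` the constant is `D² = 25`, e.g. `n = 2`: `81 − 2·1·4·7 = 25`), typed at `n + 2`:
`L_nL_{n+1}L_{n+3}L_{n+4} + 25 = L_{n+2}⁴`. [cite: AndricaBagdasar2020, Thm 2.13 (2.57)] -/
theorem lucas_gelin_cesaro (n : ℕ) :
    lucas n * lucas (n + 1) * lucas (n + 3) * lucas (n + 4) + 25 = lucas (n + 2) ^ 4 := by
  have h := solution_gelin_cesaro (U := fun n => ((Nat.fib n : ℕ) : ℤ)) (W := fun n => ((lucas n : ℕ) : ℤ))
    (by simp) (by simp) fibZ_rec'' lucasZ_rec'' n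
  have l0 : lucas 0 = 2 := rfl
  have l1 : lucas 1 = 1 := rfl
  have l2 : lucas 2 = 3 := rfl
  simp only [l0, l1, l2, Nat.cast_ofNat, Nat.cast_one] at h
  have h' : ((lucas n : ℕ) : ℤ) * (lucas (n + 1) : ℕ) * (lucas (n + 3) : ℕ) * (lucas (n + 4) : ℕ) + 25 =
      ((lucas (n + 2) : ℕ) : ℤ) ^ 4 := by
    rw [h, pow_add, pow_mul]; ring
  exact_mod_cast h'

end Fibonacci

/-! ## Pell and Pell–Lucas numbers (hypothesis form `P = 2`, `Q = −1`): (2.53), (2.54), (2.58), (2.59) -/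

section Pell

variable {Pl Ql : ℕ → ℤ}

/-- **(2.53)** (Melham for the Pell numbers `0, 1, 2, 5, 12, …`):
`P_{n+1}P_{n+2}P_{n+6} − P_{n+3}³ = (−1)ⁿ(8P_{n+2} − P_{n+1})`. [cite: AndricaBagdasar2020, Thm 2.11 (2.53)] -/
theorem pell_melham (hP0 : Pl 0 = 0) (hP1 : Pl 1 = 1) (hPl : ∀ n, Pl (n + 2) = 2 * Pl (n + 1) - (-1) * Pl n)
    (n : ℕ) : Pl (n + 1) * Pl (n + 2) * Pl (n + 6) - Pl (n + 3) ^ 3 = (-1) ^ n * (8 * Pl (n + 2) - Pl (n + 1)) := by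
  have h2 : Pl 2 = 2 := by rw [hPl 0, hP0, hP1]; ring
  rw [solution_melham hPl n, h2, hP0, hP1, pow_succ]; ring

/-- **(2.54)** (Melham for the Pell–Lucas numbers `2, 2, 6, 14, …`):
`Q_{n+1}Q_{n+2}Q_{n+6} − Q_{n+3}³ = 8(−1)^{n+1}(8Q_{n+2} − Q_{n+1})`. [cite: AndricaBagdasar2020, Thm 2.11 (2.54)] -/
theorem pellLucas_melham (hQ0 : Ql 0 = 2) (hQ1 : Ql 1 = 2) (hQl : ∀ n, Ql (n + 2) = 2 * Ql (n + 1) - (-1) * Ql n)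
    (n : ℕ) :
    Ql (n + 1) * Ql (n + 2) * Ql (n + 6) - Ql (n + 3) ^ 3 = 8 * (-1) ^ (n + 1) * (8 * Ql (n + 2) - Ql (n + 1)) := by
  have h2 : Ql 2 = 6 := by rw [hQl 0, hQ0, hQ1]; ring
  rw [solution_melham hQl n, h2, hQ0, hQ1]; ring

/-- **(2.58)**: `P_n⁴ − P_{n−2}P_{n−1}P_{n+1}P_{n+2} = 3(−1)ⁿP_n² + 4`, typed at `n + 2`.
[cite: AndricaBagdasar2020, Thm 2.13 (2.58)] -/
theorem pell_gelin_cesaro (hP0 : Pl 0 = 0) (hP1 : Pl 1 = 1)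
    (hPl : ∀ n, Pl (n + 2) = 2 * Pl (n + 1) - (-1) * Pl n) (n : ℕ) :
    Pl (n + 2) ^ 4 - Pl n * Pl (n + 1) * Pl (n + 3) * Pl (n + 4) = 3 * (-1) ^ n * Pl (n + 2) ^ 2 + 4 := by
  have h2 : Pl 2 = 2 := by rw [hPl 0, hP0, hP1]; ring
  rw [solution_gelin_cesaro hP0 hP1 hPl hPl n, h2, hP0, hP1, pow_add, pow_mul]; ring

/-- **(2.59)**: `Q_n⁴ − Q_{n−2}Q_{n−1}Q_{n+1}Q_{n+2} = 24(−1)^{n−1}Q_n² + 256`, typed at `n + 2` (`(−1)^{n+1}`).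
[cite: AndricaBagdasar2020, Thm 2.13 (2.59)] -/
theorem pellLucas_gelin_cesaro (hP0 : Pl 0 = 0) (hP1 : Pl 1 = 1)
    (hPl : ∀ n, Pl (n + 2) = 2 * Pl (n + 1) - (-1) * Pl n) (hQ0 : Ql 0 = 2) (hQ1 : Ql 1 = 2)
    (hQl : ∀ n, Ql (n + 2) = 2 * Ql (n + 1) - (-1) * Ql n) (n : ℕ) :
    Ql (n + 2) ^ 4 - Ql n * Ql (n + 1) * Ql (n + 3) * Ql (n + 4) = 24 * (-1) ^ (n + 1) * Ql (n + 2) ^ 2 + 256 := by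
  have h2 : Ql 2 = 6 := by rw [hQl 0, hQ0, hQ1]; ring
  rw [solution_gelin_cesaro hP0 hP1 hPl hQl n, h2, hQ0, hQ1, pow_add, pow_mul]; ring

end Pell

end Literature.NumberTheory.LucasSequences
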